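import Mathlib.Analysis.Complex.Basic
import Mathlib.Analysis.Calculus.Deriv.Basic
import Mathlib.Algebra.BigOperators.Finprod
import Mathlib.Topology.Algebra.InfiniteSum.Basic
import Mathlib.Data.Nat.Prime.Defs
import HarnessLib

/-!
# Rapoport–Smithling–Zhang 2020, §7 «L-functions and the relative trace formula» (v6 pp. 38–43) — as a LETTER:
# one posited datum, the printed definitions as `def`s with bodies over it, the printed statements
# (Propositions 7.1, 7.2, Remarks 7.3, 7.8, 7.11, Lemma 7.12, displays (7.1)–(7.17)) as relations; nothing asserted

M. Rapoport, B. Smithling, W. Zhang, *Arithmetic diagonal cycles on unitary Shimura varieties*, Compositio Math.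
**156** (2020) 1745–1824 = arXiv:1710.06962 **v6** [RapoportSmithlingZhang2020Diagonal], §7.  Source text of
record (squad TKR sheet §A, lit1 kit): `run/shared/lean/pub/hodgecm-mathlib/F0/P6/lit1/RSZ2020-v6-pages.txt`,
blocks «arXiv v6 page N», pp. 38–43, with the item map `RSZ2020-v6-itemmap.lit1-g5.md` (15cc0883): Prop. 7.1
p. 39 · Prop. 7.2, Rem. 7.3–7.4, Def. 7.5 p. 40 · (7.7)–(7.13), Def. of `J_v`, `∂J` p. 41 · (7.14)–(7.16),
Def. 7.6–7.7, Rem. 7.8 p. 42 · Def. 7.9–7.10, Rem. 7.11, Lemma 7.12, (7.17) p. 43.  Pins «p. N» = v6 page.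
Squad TKR (HCML «GO 500»), typer TKR-t06 (= TK-t01); target
`Literature/AlgebraicGeometry/ShimuraVarieties/RapoportSmithlingZhang2020/Sec7LFunctionsRTF.lean`, namespace
`Literature.AlgebraicGeometry.ShimuraVarieties.RapoportSmithlingZhang2020.Sec7LFunctionsRTF`.  STATEMENTS ONLY
(cell TYPER LINT RULE): no theorem, no proof, no `sorry`, no `axiom`, no `instance`, no `notation`.

## Source, verbatim (abridged; v6 pages)

(p. 38) «**7.** In this section, we recall certain distributions on the group `G′ = Res_{F/F₀}(GL_{n−1} × GL_n)`
that appear in the context of the relative trace formula … **7.1. The L-function.** Let `π = π₁ ⊠ π₂` be a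
cuspidal automorphic representation of `G′(𝔸_{F₀})` … Let `L(s, π₁ × π₂)` be the Rankin–Selberg convolution
L-function. This is an entire function in `s ∈ ℂ` and it satisfies a functional equation of the form
`L(s, π₁ × π₂) = ε(s, π₁ × π₂) L(1 − s, π₁^∨ × π₂^∨)` … Let `φ = ⊗_v φ_v ∈ π` be a decomposable vector.
Consider the integral `λ(φ, s) := ∫_{H′₁(F₀)\H′₁(𝔸_{F₀})} φ(h) |det(h)|_F^s dh` (7.1). Then … we have a
decomposition `λ(φ, s) = L(s + ½, π₁ × π₂) ∏_v λ_v(φ_v, s)`. Here the left-hand side is an entire function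
in `s ∈ ℂ`, and the local factors `λ_v(φ_v, s)` have the following properties. (1) For every `φ_v ∈ π_v`, the
function `s ↦ λ_v(φ_v, s)` is entire, and there exists `φ°_v` such that `λ_v(φ°_v, s) ≡ 1`. (2) For any
decomposable `φ = ⊗_v φ_v`, we have `λ_v(φ_v, s) ≡ 1` for all but finitely many `v`. It follows that if
`L(½, π₁ × π₂) = 0` …, then `d/ds|_{s=0} λ(φ, s) = L′(½, π₁ × π₂) ∏_v λ_v(φ_v, 0)`.»  (p. 39) «**7.2.** … Let
`f′ = ⊗_v f′_v ∈ ℋ(G′(𝔸_{F₀}))` be a pure tensor … `K_{f′}` (7.2) … `J(f′, s) := ∫∫ K_{f′}(h₁, h₂) η(h₂)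
|det(h₁)|^s dh₁ dh₂` (7.3) … a cuspidal automorphic representation `π` contributes `J_π(f′, s)` … **Proposition
7.1.** Let `π = π₁ ⊠ π₂` be cuspidal, and assume that it is the base change of an automorphic representation
of (quasi-split) unitary groups. If `L(½, π₁ × π₂) = 0`, then `d/ds|_{s=0} J_π(f′, s) = L(1, η)² L′(½, π₁ ×
π₂) / L(1, π, Ad) · ∏_v J_{π_v}(f′_v)`, where `J_{π_v}(f′_v)` is the local distribution defined in [58, §3,
(3.31)], and `L(1, π, Ad)` is the adjoint L-function. [Proof: `J_π(f′, s) = L(1, η)² L(s + ½, π₁ × π₂) /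
L(1, π, Ad) · ∏_v J_{π_v}(f′_v, s)` (7.4), with `J_{π_v}(f′_v, s)` (7.5), `J_{π_v}(f′_v, 0) = J_{π_v}(f′_v)`
by definition.]»  (p. 40) «**Proposition 7.2.** Let `f′ = ⊗_v f′_v` be a pure tensor. Suppose that for a split
place `v` the function `f′_v` has the property that, for every character `χ_v` of the center …, the function
`f′_{v,χ_v}` … is the sum of matrix coefficients of supercuspidal representations. Then the integral (7.3)
converges absolutely and it decomposes as `J(f′, s) = Σ_π J_π(f′, s) = Σ_π L(1, η)² L(s + ½, π₁ × π₂) /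
L(1, π, Ad) · ∏_v J_{π_v}(f′_v, s)`, where the sum runs through the set of cuspidal automorphic
representations `π` of `G′(𝔸_{F₀})` coming by base change from … unitary groups.  **Remark 7.3.** There are
many test functions `f′_v` with the property in the above statement. It suffices to construct such functions
for `GL_m(F)` where `F` is a p-adic local field … It follows that for `f′` as in Proposition 7.2, we have an
expansion for the first derivative `d/ds|_{s=0} J(f′, s) = Σ_{ε(π)=−1} L(1,η)² L′(½, π₁ × π₂)/L(1, π, Ad) ∏_v
J_{π_v}(f′_v, 0) + Σ_{ε(π)=1} L(1,η)² L(½, π₁ × π₂)/L(1, π, Ad) · d/ds|_{s=0} ∏_v J_{π_v}(f′_v, s)` (7.6).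
Here `ε(π) = ε(½, π₁ × π₂)` is the global root number.  **Remark 7.4.** … non-cuspidal … we will not touch on
this topic …  **Definition 7.5.** … `f′_ν` has regular support if `supp(f′_ν) ⊂ G′(F_{0,ν})_rs`. A pure tensor
`f′` has regular support at `ν` if `f′_ν` has regular support.»  (p. 41) «… by [55, Lem. 3.2] the integral (7.3)
is absolutely convergent for all `s`, and admits a decomposition into a finite sum … `J(f′, s) = Σ_{γ ∈
G′(F₀)_rs/H′_{1,2}(F₀)} Orb(γ, f′, s)` (7.7), … `Orb(γ, f′, s) = ∏_v Orb(γ, f′_v, s)` (7.8) … We set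
`J(f′) := J(f′, 0)` (7.9) … `J_v(f′, s) := Σ_γ Orb(γ, f′_v, s) · ∏_{u ≠ v} Orb(γ, f′_u)` … `∂J(f′) := d/ds|_{s=0}
J(f′, s)`, `∂J_v(f′) := d/ds|_{s=0} J_v(f′, s)`, `∂Orb(γ, f′_v) := d/ds|_{s=0} Orb(γ, f′_v, s)` (7.10). Note that
`∂J_v(f′) = Σ_γ ∂Orb(γ, f′_v) · ∏_{u≠v} Orb(γ, f′_u)` (7.11). Then we may decompose `∂J(f′) = Σ_v ∂J_v(f′)`
(7.12). … the truncation process of Zydor [61] allows us to define a meromorphic distribution `J(·, s)` which is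
holomorphic away from `s = −1` … **7.3. Smooth transfer.** … the transfer factor … `ω(γ) = ∏_v ω_v(γ_v)`
(7.13).»  (p. 42) «(1) (η-invariance) `ω(h₁⁻¹ γ h₂) = η(h₂) ω(γ)`. (2) (product formula) For `γ ∈ G′(F₀)` we
have `∏_v ω_v(γ) = 1` (7.14). … `Orb(g, f_p) := ∫ f_p(h₁⁻¹ g h₂) dh₁ dh₂` (7.15).  **Definition 7.6.** A function
`f_p ∈ C_c^∞(H̃G(ℚ_p))` and a collection `(f′_v) ∈ ∏_{v∣p} C_c^∞(G′(F_{0,v}))` of functions are transfers of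
each other if for any element `γ = (γ_v) ∈ ∏_{v∣p} G′(F_{0,v})_rs`: `ω(γ) ∏_{v∣p} Orb(γ_v, f′_v) = Orb(g, f_p)`
whenever `g` matches `γ`; `= 0` if no `g ∈ H̃G(ℚ_p)` matches `γ`. We make the same definition for … `ℝ` …
**Definition 7.7.** `f_p` is completely decomposed if `f_p = φ_p ⊗ ⊗_{v∣p} f_v` (7.16) …  **Remark 7.8.** Let
`f_p = φ_p ⊗ ⊗ f_v` be completely decomposed. Set `c(φ_p) := ∫_{Z^ℚ(ℚ_p)} φ_p(z) dz`. By Lemma 2.1, … `Orb(g,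
f_p) = c(φ_p) ∏_{v∣p} Orb(g_v, f_v)` … If the orbital integrals of `f_p` do not vanish identically, then `f_p`
and `(f′_v)_{v∣p}` are transfers of each other … if and only if for some non-zero constants `c_v` such that
`c(φ_p) = ∏_{v∣p} c_v`, the functions `f_v` and `c_v f′_v` are transfers of each other for each `v` in the sense
of [43, §2].»  (p. 43) «**Definition 7.9.** … `f′_v` is a Gaussian test function if it transfers to the constant
function `1` on `G_{W₀}(F_{0,v})`, where `W₀` denotes the negative-definite hermitian space, and transfers to
the zero function on `G_W(F_{0,v})` for any other hermitian space `W` … A pure tensor `f′` is a Gaussian test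
function if the archimedean components `f′_v` for `v ∣ ∞` are all (up to scalar factor) Gaussian … `f′_v` is a
Gaussian test function if and only if for all `γ ∈ G′(F_{0,v})_rs`, `ω_v(γ) Orb(γ, f′_v) = 1` if there exists
`g ∈ G_{W₀}(F_{0,v})` matching `γ`, `0` if not (7.17). [A sentence on the (unknown) existence of Gaussian
test functions follows.] …  **Definition 7.10.** A pure tensor `f = ⊗_p f_p ∈ ℋ(H̃G(𝔸_f))` and a pure tensor `f′ = ⊗_v
f′_v ∈ ℋ(G′(𝔸_{F₀,f}))` are smooth transfers of each other if they are expressible in a way that `f_p` and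
`(f′_v)_{v∣p}` are transfers of each other for each prime `p` …  **Remark 7.11.** The existence of local smooth
transfer is known for non-archimedean places [57]; hence for any `f` … there exists a smooth transfer `f′` …
and conversely.  **Lemma 7.12.** Let `f′ = ⊗_v f′_v ∈ ℋ(G′(𝔸_{F₀}))` be a Gaussian test function. Assume that
`f′` has regular support at some place `ν` of `F₀`. Then for any place `v₀` of `F₀` split in `F`,
`∂J_{v₀}(f′) = 0`.»

## What is typed, and how

Neither Mathlib nor the tree has automorphic representations of `GL_{n−1} × GL_n` over a CM extension
(the tree's `Literature.NumberTheory.Automorphic.CuspidalAutomorphicRepData n K …` types cusp forms on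
`GL_n(𝔸_K)` and could instantiate each factor `πᵢ`), Rankin–Selberg L-functions of pairs of automorphic
representations (the tree's `rankinSelberg*` are `GL₂`-modular forms), automorphic kernels, relative-trace-formula
distributions, Jacquet–Rallis transfer factors or smooth transfer; the groups `G′, H′₁, H′₂, H̃G, G_W, Z^ℚ` of
§2 are typed functor-of-points-style in ★ `RapoportSmithlingZhang2020.Sec2GroupTheoreticSetup` (`Sec2Datum`,
`G'pts`, `H'₁pts`, `H'₂pts`, `GWpts`, `HGtilde`, `ZQ`) — TODO(import): the bare point-carriers below (`GlocRs`,
`Grs`, `HGp`, `GWpt`) are kept posited because §7 needs the local ∕ adelic points WITH their regular-semisimple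
loci, Haar measures and orbital integrals, which that file does not carry; a later pass can tie them to its
`Sec2Datum` points.  So §7 is a LETTER over ONE posited datum `Sec7Data` (bare carriers ∕ maps ∕ predicates,
each with its page pin), with REAL bodies wherever the print DEFINES something from the posited primitives:
(7.9) `J₀`, (7.10) `dJ`, `dJv`, `dOrb` via Mathlib `deriv`; `Jv` via `finsum`∕`finprod`; the transfer factor
of a tuple and (7.8)-products via `finprod`; Def. 7.5 `HasRegularSupportAt`, Def. 7.6 `AreTransfersAt`,
Def. 7.7 `IsCompletelyDecomposed`, Def. 7.9 `IsGaussianLoc`∕`IsGaussian`, Def. 7.10 `AreSmoothTransfers`, the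
root number `rootNumber`.  Sums over cuspidal `π` (Prop. 7.2, (7.6)) are Mathlib `HasSum`∕`tsum`-free
existential sums (`HasSum`); «entire» = `Differentiable ℂ`; «`≡ 1` for almost all `v`» = finiteness of the
exceptional set; the finite sum (7.7) = `finsum` with its support finite (as printed); (7.12) `Σ_v` = `finsum`
(the print's sum is finite for `f′` of regular support).  Places of `F₀` are a posited type `Pl` with
predicates `IsArch`, `IsSplit` (split in `F`) and `Over v p` (lies over the rational prime `p : Nat.Primes`).
Nothing in the structure asserts a printed statement; every numbered statement is a `Prop`-valued `def`.
NOT typed: the kernel `K_{f′}` (7.2) and the double integral (7.3) themselves (only the resulting distribution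
`J`), the Flicker–Rallis period, Zydor's truncation, Remark 7.4 (prose, no statement), the proofs.
DEDUP: `rg "RapoportSmithlingZhang20(17|20)(Diagonal)?, (§ ?7|Prop.* 7\.|Lemma 7\.|\(7\.)"` over
`lean/Literature lean/Summits` = ∅ (squad sheet §C: §§5–8 green field).

## References
* [RapoportSmithlingZhang2020Diagonal] M. Rapoport, B. Smithling, W. Zhang, Compositio Math. 156 (2020)
  1745–1824 = arXiv:1710.06962v6, §7 pp. 38–43.
-/

noncomputable section

namespace Literature.AlgebraicGeometry.ShimuraVarieties.RapoportSmithlingZhang2020.Sec7LFunctionsRTF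

universe u

/-- **The data of RSZ §7 AS A DATUM** (CM extension `F/F₀` with quadratic character `η = η_{F/F₀}`, `n`,
`G′ = Res_{F/F₀}(GL_{n−1} × GL_n)`, `H′₁`, `H′₂`, `H′_{1,2}`, the hermitian-space groups `G_W`, `H̃G`, `Z^ℚ`
of §2 and the Haar measures of [58, §2] fixed behind it).  Carriers: places of `F₀` (`Pl`, `IsArch`,
`IsSplit`, `Over`); cuspidal automorphic representations `π = π₁ ⊠ π₂` of `G′(𝔸_{F₀})` (`CuspRep`) with
contragredient, decomposable vectors and the predicate «base change from unitary groups»; the L-functions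
`L(s, π₁ × π₂)`, `ε(s, π₁ × π₂)`, `L(s, η)`, `L(s, π, Ad)`; the period integral `λ(φ, s)` and its local factors;
the Hecke algebra of pure tensors `f′` (`TestFn`) with local components, the distributions `J(f′, s)`,
`J_π(f′, s)`, the local `J_{π_v}(f′_v, s)` (their product (7.4) is a `finprod` def); the supercuspidal-matrix-coefficient property of
Prop. 7.2; regular semisimple supports and orbits with the orbital integrals `Orb(γ, f′_v, s)` and `Orb(γ,
f′, s)`; local∕adelic regular semisimple elements with the transfer factors `ω_v`, `ω`, the `H′₁ × H′₂`-action
and `η`; the unitary side at `p`: `H̃G(ℚ_p)`, its test functions, `Orb(g, f_p)`, matching, `Z^ℚ`-test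
functions with `c(φ_p)`, `G_W(F_{0,v})`-test functions, the pure-tensor map (7.16), the local orbital integrals
`Orb(g_v, f_v)`, the local transfer relation of [43, §2] and scalar multiples; hermitian spaces at archimedean
`v` with `W₀` and the constant test functions `1`, `0`; the finite-adelic pure tensors of Def. 7.10.
[cite: RapoportSmithlingZhang2020Diagonal, §7 (pp. 38–43)] -/
structure Sec7Data : Type (u + 1) where
  /-- the places `v` of `F₀` [§7.1 p. 38] -/
  Pl : Type u
  /-- «`v ∣ ∞`» [Def. 7.9 p. 43] -/
  IsArch : Pl → Prop
  /-- «`v` split in `F`» [Prop. 7.2 p. 40; Lemma 7.12 p. 43] -/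
  IsSplit : Pl → Prop
  /-- «`v ∣ p`», `p` a rational prime [§7.3 p. 42] -/
  Over : Pl → Nat.Primes → Prop
  /-- the cuspidal automorphic representations `π = π₁ ⊠ π₂` of `G′(𝔸_{F₀})` [§7.1 p. 38] -/
  CuspRep : Type u
  /-- `π ↦ π^∨ = π₁^∨ ⊠ π₂^∨` (contragredient) [§7.1 p. 38] -/
  dual : CuspRep → CuspRep
  /-- «`π` is the base change of an automorphic representation of (quasi-split) unitary groups» [Prop. 7.1 p. 39] -/
  IsBaseChange : CuspRep → Prop
  /-- the Rankin–Selberg L-function `s ↦ L(s, π₁ × π₂)` [§7.1 p. 38] -/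
  L : CuspRep → ℂ → ℂ
  /-- the epsilon factor `s ↦ ε(s, π₁ × π₂)` [§7.1 p. 38] -/
  eps : CuspRep → ℂ → ℂ
  /-- `s ↦ L(s, η)`, `η = η_{F/F₀}` [Prop. 7.1 p. 39] -/
  Leta : ℂ → ℂ
  /-- the adjoint L-function `s ↦ L(s, π, Ad)` [Prop. 7.1 p. 39] -/
  Lad : CuspRep → ℂ → ℂ
  /-- the decomposable vectors `φ = ⊗_v φ_v ∈ π` [§7.1 p. 38] -/
  Vec : CuspRep → Type u
  /-- the period integral `λ(φ, s)` (7.1) [§7.1 p. 38] -/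
  lam : {π : CuspRep} → Vec π → ℂ → ℂ
  /-- the local factors `λ_v(φ_v, s)` [§7.1 p. 38] -/
  lamLoc : {π : CuspRep} → Vec π → Pl → ℂ → ℂ
  /-- the pure tensors `f′ = ⊗_v f′_v ∈ ℋ(G′(𝔸_{F₀}))` [§7.2 p. 39] -/
  TestFn : Type u
  /-- the local test functions `f′_v ∈ C_c^∞(G′(F_{0,v}))` [§7.2 p. 39] -/
  TestFnLoc : Pl → Type u
  /-- the local component `f′_v` of a pure tensor [§7.2 p. 39] -/
  comp : TestFn → (v : Pl) → TestFnLoc v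
  /-- scalar multiples `c f′_v` of local test functions [Rem. 7.8 p. 42; Def. 7.9 p. 43 «up to scalar factor»] -/
  smulLoc : {v : Pl} → ℂ → TestFnLoc v → TestFnLoc v
  /-- the global distribution `s ↦ J(f′, s)` (7.3), in general defined by Zydor's truncation [§7.2 pp. 39, 41] -/
  J : TestFn → ℂ → ℂ
  /-- «the integral (7.3) converges absolutely» at `s` [Prop. 7.2 p. 40; p. 41] -/
  JConverges : TestFn → ℂ → Prop
  /-- the contribution `s ↦ J_π(f′, s)` of a cuspidal `π` [§7.2 p. 39] -/
  Jpi : CuspRep → TestFn → ℂ → ℂ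
  /-- the local distributions `s ↦ J_{π_v}(f′_v, s)` (7.5), `J_{π_v}(f′_v) = J_{π_v}(f′_v, 0)` [Prop. 7.1 p. 39; (7.5)] -/
  Jloc : CuspRep → (v : Pl) → TestFnLoc v → ℂ → ℂ
  /-- the property of Prop. 7.2 at `v`: «for every character `χ_v` of the center …, `f′_{v,χ_v}` is the sum of
  matrix coefficients of supercuspidal representations» [Prop. 7.2 p. 40] -/
  HasSupercuspidalProperty : (v : Pl) → TestFnLoc v → Prop
  /-- «`supp(f′_ν) ⊂ G′(F_{0,ν})_rs`» [Def. 7.5 p. 40] -/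
  SuppRegular : (v : Pl) → TestFnLoc v → Prop
  /-- the regular semisimple orbits `γ ∈ G′(F₀)_rs / H′_{1,2}(F₀)` [(7.7) p. 41] -/
  Orbit : Type u
  /-- the local orbital integrals `s ↦ Orb(γ, f′_v, s)` [(7.8) p. 41] -/
  orbLoc : Orbit → (v : Pl) → TestFnLoc v → ℂ → ℂ
  /-- the global orbital integral `s ↦ Orb(γ, f′, s) = ∏_v Orb(γ, f′_v, s)` (7.8) [p. 41] -/
  orb : Orbit → TestFn → ℂ → ℂ
  /-- the regular semisimple elements `γ_v ∈ G′(F_{0,v})_rs` [§7.3 pp. 41–43] -/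
  GlocRs : Pl → Type u
  /-- the local transfer factors `ω_v` of [43, §2.4] [(7.13) p. 41] -/
  omegaLoc : (v : Pl) → GlocRs v → ℂ
  /-- the regular semisimple adelic elements `γ = (γ_v) ∈ G′(𝔸_{F₀})` [(7.13) p. 41] -/
  GadRs : Type u
  /-- the local components of an adelic element [(7.13) p. 41] -/
  locOf : GadRs → (v : Pl) → GlocRs v
  /-- the rational regular semisimple elements `γ ∈ G′(F₀)`, diagonally in `G′(𝔸_{F₀})` [(7.14) p. 42] -/
  Grs : Type u
  /-- `G′(F₀)_rs → G′(𝔸_{F₀})_rs` [(7.14) p. 42] -/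
  diag : Grs → GadRs
  /-- `H′₁(𝔸_{F₀})` [(7.14)(1) p. 42] -/
  H1A : Type u
  /-- `H′₂(𝔸_{F₀})` [(7.14)(1) p. 42] -/
  H2A : Type u
  /-- `(h₁, γ, h₂) ↦ h₁⁻¹ γ h₂` [(7.14)(1) p. 42] -/
  act : H1A → GadRs → H2A → GadRs
  /-- the quadratic character `η` on `H′₂(𝔸_{F₀})` [§7.2 p. 39; (7.14)(1) p. 42] -/
  eta : H2A → ℂ
  /-- `H̃G(ℚ_p)` [(7.15) p. 42] -/
  HGp : Nat.Primes → Type u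
  /-- «`g ∈ H̃G(ℚ_p)_rs`» [(7.15) p. 42] -/
  IsRsU : {p : Nat.Primes} → HGp p → Prop
  /-- `C_c^∞(H̃G(ℚ_p))` [(7.15) p. 42] -/
  TestFnU : Nat.Primes → Type u
  /-- the orbital integral `Orb(g, f_p)` (7.15) [p. 42] -/
  orbU : {p : Nat.Primes} → HGp p → TestFnU p → ℂ
  /-- «`g` matches `γ`», `γ = (γ_v)_{v∣p}` [Def. 7.6 p. 42] -/
  Matches : {p : Nat.Primes} → HGp p → ((v : Pl) → Over v p → GlocRs v) → Prop
  /-- `C_c^∞(Z^ℚ(ℚ_p))` [Def. 7.7 p. 42] -/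
  TestFnZ : Nat.Primes → Type u
  /-- `c(φ_p) := ∫_{Z^ℚ(ℚ_p)} φ_p(z) dz` [Rem. 7.8 p. 42] -/
  cZ : {p : Nat.Primes} → TestFnZ p → ℂ
  /-- `C_c^∞(G_W(F_{0,v}))` for the hermitian space `W` of §2 [Def. 7.7 p. 42] -/
  TestFnGW : Pl → Type u
  /-- the pure tensor `φ_p ⊗ ⊗_{v∣p} f_v ∈ C_c^∞(H̃G(ℚ_p))` (7.16) [Def. 7.7 p. 42] -/
  tensorAt : (p : Nat.Primes) → TestFnZ p → ((v : Pl) → Over v p → TestFnGW v) → TestFnU p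
  /-- `G_W(F_{0,v})` (points) [Rem. 7.8 p. 42] -/
  GWpt : Pl → Type u
  /-- «`g ∈ H̃G(ℚ_p)` corresponding to the collection `g_v ∈ (H × G)(F_{0,v})`» (Lemma 2.1) [Rem. 7.8 p. 42] -/
  glocOf : {p : Nat.Primes} → HGp p → (v : Pl) → Over v p → GWpt v
  /-- the local orbital integral `Orb(g_v, f_v)` of [43, §2] [Rem. 7.8 p. 42] -/
  orbGW : {v : Pl} → GWpt v → TestFnGW v → ℂ
  /-- «the orbital integrals of `f_p` do not vanish identically» [Rem. 7.8 p. 42] -/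
  OrbNonVanishing : {p : Nat.Primes} → TestFnU p → Prop
  /-- «`f_v` and `f′_v` are transfers of each other in the sense of [43, §2]» [Rem. 7.8 p. 42] -/
  IsLocalTransfer : {v : Pl} → TestFnGW v → TestFnLoc v → Prop
  /-- the isomorphism classes of hermitian spaces `W` of dimension `n` over `F_v` [Def. 7.9 p. 43] -/
  Herm : Pl → Type u
  /-- «`W₀` denotes the negative-definite hermitian space» (`v` archimedean) [Def. 7.9 p. 43] -/
  W0 : (v : Pl) → Herm v
  /-- `C_c^∞(G_W(F_{0,v}))` for a hermitian space `W` [Def. 7.9 p. 43] -/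
  TestFnW : (v : Pl) → Herm v → Type u
  /-- the constant function `1` on `G_{W₀}(F_{0,v})` (compact) [Def. 7.9 p. 43] -/
  oneW0 : (v : Pl) → TestFnW v (W0 v)
  /-- the zero function on `G_W(F_{0,v})` [Def. 7.9 p. 43] -/
  zeroW : (v : Pl) → (W : Herm v) → TestFnW v W
  /-- «`f′_v` transfers to `f` on `G_W(F_{0,v})`» [Def. 7.9 p. 43] -/
  TransfersTo : {v : Pl} → {W : Herm v} → TestFnLoc v → TestFnW v W → Prop
  /-- `G_{W₀}(F_{0,v})` (points) with matching to `G′(F_{0,v})_rs` [(7.17) p. 43] -/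
  GW0pt : Pl → Type u
  /-- «`g ∈ G_{W₀}(F_{0,v})` matching `γ`» [(7.17) p. 43] -/
  MatchesW0 : {v : Pl} → GW0pt v → GlocRs v → Prop
  /-- `Orb(γ, f′_v) = Orb(γ, f′_v, 0)` as a function of the regular semisimple ELEMENT `γ` [(7.17) p. 43] -/
  orbLocElt : {v : Pl} → GlocRs v → TestFnLoc v → ℂ
  /-- the pure tensors `f = ⊗_p f_p ∈ ℋ(H̃G(𝔸_f))` [Def. 7.10 p. 43] -/
  TestFnUf : Type u
  /-- the `p`-component `f_p` [Def. 7.10 p. 43] -/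
  compU : TestFnUf → (p : Nat.Primes) → TestFnU p
  /-- the pure tensors `f′ = ⊗_v f′_v ∈ ℋ(G′(𝔸_{F₀,f}))` (finite adeles) [Def. 7.10 p. 43] -/
  TestFnf : Type u
  /-- the local component `f′_v` (`v` non-archimedean) [Def. 7.10 p. 43] -/
  compf : TestFnf → (v : Pl) → TestFnLoc v

namespace Sec7Data

variable (D : Sec7Data.{u})

/-! ## §7.1 The L-function (p. 38) -/

/-- The global root number `ε(π) = ε(½, π₁ × π₂)` [(7.6) p. 40]. [cite: RapoportSmithlingZhang2020Diagonal, §7.2 (7.6) (p. 40)] -/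
def rootNumber (π : D.CuspRep) : ℂ := D.eps π (1 / 2)

/-- §7.1 (p. 38): «`L(s, π₁ × π₂)` … is an entire function in `s ∈ ℂ` and it satisfies a functional equation
of the form `L(s, π₁ × π₂) = ε(s, π₁ × π₂) L(1 − s, π₁^∨ × π₂^∨)`». [cite: RapoportSmithlingZhang2020Diagonal, §7.1 (p. 38)] -/
def RSZ2020_7_1_L_entire_functionalEquation : Prop :=
  ∀ π : D.CuspRep, Differentiable ℂ (D.L π) ∧ ∀ s : ℂ, D.L π s = D.eps π s * D.L (D.dual π) (1 - s)

/-- §7.1 (p. 38), the decomposition of (7.1) and properties (1), (2): «`λ(φ, s) = L(s + ½, π₁ × π₂) ∏_v λ_v(φ_v,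
s)`. Here the left-hand side is an entire function in `s ∈ ℂ`, and … (1) for every `φ_v ∈ π_v`, the function
`s ↦ λ_v(φ_v, s)` is entire, and there exists `φ°_v` such that `λ_v(φ°_v, s) ≡ 1`. (2) For any decomposable
`φ`, we have `λ_v(φ_v, s) ≡ 1` for all but finitely many `v`.» (So the product is the `finprod`.)
[cite: RapoportSmithlingZhang2020Diagonal, §7.1 (7.1) (p. 38)] -/
def RSZ2020_7_1_lambda_decomposition : Prop :=
  ∀ (π : D.CuspRep) (φ : D.Vec π),
    Differentiable ℂ (D.lam φ) ∧ (∀ v : D.Pl, Differentiable ℂ (D.lamLoc φ v)) ∧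
    {v : D.Pl | D.lamLoc φ v ≠ fun _ => 1}.Finite ∧
    (∀ v : D.Pl, ∃ φ₀ : D.Vec π, D.lamLoc φ₀ v = fun _ => 1) ∧
    ∀ s : ℂ, D.lam φ s = D.L π (s + 1 / 2) * ∏ᶠ v : D.Pl, D.lamLoc φ v s

/-- §7.1 (p. 38): «It follows that if `L(½, π₁ × π₂) = 0` …, then `d/ds|_{s=0} λ(φ, s) = L′(½, π₁ × π₂) ∏_v
λ_v(φ_v, 0)`.» [cite: RapoportSmithlingZhang2020Diagonal, §7.1 (p. 38)] -/
def RSZ2020_7_1_lambda_derivative : Prop :=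
  ∀ (π : D.CuspRep) (φ : D.Vec π), D.L π (1 / 2) = 0 →
    deriv (D.lam φ) 0 = deriv (D.L π) (1 / 2) * ∏ᶠ v : D.Pl, D.lamLoc φ v 0

/-! ## §7.2 The global distribution on `G′` (pp. 39–41) -/

/-- The product `s ↦ ∏_v J_{π_v}(f′_v, s)` of the local distributions (7.5) [Prop. 7.1 p. 39; (7.4)] (`finprod`; it
is the finite product of the factors `≢ 1`, cf. the finiteness clauses in `Eq74` ∕ Prop. 7.2).
[cite: RapoportSmithlingZhang2020Diagonal, §7.2 (7.4)–(7.5) (p. 39)] -/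
def prodJloc (π : D.CuspRep) (f : D.TestFn) (s : ℂ) : ℂ := ∏ᶠ v : D.Pl, D.Jloc π v (D.comp f v) s

/-- (7.4) (p. 39), for `π` cuspidal coming by base change from unitary groups: «`J_π(f′, s) = L(1, η)² L(s + ½,
π₁ × π₂) / L(1, π, Ad) · ∏_v J_{π_v}(f′_v, s)`» ([58, Prop. 3.6]; the product over all `v` is read with `J_{π_v}(f′_v,
s) ≡ 1` for all but finitely many `v`, as for (7.1) (2)). [cite: RapoportSmithlingZhang2020Diagonal, §7.2 (7.4) (p. 39)] -/
def Eq74 : Prop :=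
  ∀ (π : D.CuspRep) (f : D.TestFn), D.IsBaseChange π →
    {v : D.Pl | D.Jloc π v (D.comp f v) ≠ fun _ => 1}.Finite ∧
    ∀ s : ℂ, D.Jpi π f s = D.Leta 1 ^ 2 * D.L π (s + 1 / 2) / D.Lad π 1 * D.prodJloc π f s

/-- **Proposition 7.1** (p. 39): «Let `π = π₁ ⊠ π₂` be cuspidal, and assume that it is the base change of an
automorphic representation `σ` on (quasi-split) unitary groups. If `L(½, π₁ × π₂) = 0`, then `d/ds|_{s=0}
J_π(f′, s) = L(1, η)² L′(½, π₁ × π₂) / L(1, π, Ad) · ∏_v J_{π_v}(f′_v)`, where `J_{π_v}(f′_v)` is the local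
distribution defined in [58, §3, (3.31)]» (= `J_{π_v}(f′_v, 0)`). [cite: RapoportSmithlingZhang2020Diagonal, Prop. 7.1 (p. 39)] -/
def RSZ2020_7_1_derivative_Jpi : Prop :=
  ∀ (π : D.CuspRep) (f : D.TestFn), D.IsBaseChange π → D.L π (1 / 2) = 0 →
    deriv (D.Jpi π f) 0 = D.Leta 1 ^ 2 * deriv (D.L π) (1 / 2) / D.Lad π 1 * D.prodJloc π f 0

/-- The hypothesis of Proposition 7.2 on a pure tensor `f′` (p. 40): at some place `v` split in `F`, `f′_v` has the
supercuspidal-matrix-coefficient property. [cite: RapoportSmithlingZhang2020Diagonal, Prop. 7.2 (p. 40)] -/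
def HasSupercuspidalComponent (f : D.TestFn) : Prop :=
  ∃ v : D.Pl, D.IsSplit v ∧ D.HasSupercuspidalProperty v (D.comp f v)

/-- **Proposition 7.2** (p. 40): «… Suppose that for a split place `v` the function `f′_v` has the property … Then
the integral (7.3) converges absolutely and it decomposes as `J(f′, s) = Σ_π J_π(f′, s) = Σ_π L(1, η)² L(s + ½,
π₁ × π₂) / L(1, π, Ad) · ∏_v J_{π_v}(f′_v, s)`, where the sum runs through the set of cuspidal automorphic
representations `π` … coming by base change from … unitary groups.» (Sum as Mathlib `HasSum` over that set.)
[cite: RapoportSmithlingZhang2020Diagonal, Prop. 7.2 (p. 40)] -/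
def RSZ2020_7_2_spectral_decomposition : Prop :=
  ∀ (f : D.TestFn) (s : ℂ), D.HasSupercuspidalComponent f →
    D.JConverges f s ∧
    (∀ π : D.CuspRep, D.IsBaseChange π → {v : D.Pl | D.Jloc π v (D.comp f v) ≠ fun _ => 1}.Finite) ∧
    HasSum (fun π : {π : D.CuspRep // D.IsBaseChange π} => D.Jpi π.1 f s) (D.J f s) ∧
    HasSum (fun π : {π : D.CuspRep // D.IsBaseChange π} =>
      D.Leta 1 ^ 2 * D.L π.1 (s + 1 / 2) / D.Lad π.1 1 * D.prodJloc π.1 f s) (D.J f s)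

/-- **Remark 7.3** (p. 40), existence: «There are many test functions `f′_v` with the property in the above
statement. It suffices to construct such functions for `GL_m(F)` where `F` is a p-adic local field … `f = f̃ ⊗
1_{[val=0]}` has the desired property» — the property in question is the hypothesis of Proposition 7.2 at a SPLIT
(non-archimedean) place `v`, so that is the printed scope. [cite: RapoportSmithlingZhang2020Diagonal, Rem. 7.3 (p. 40)] -/
def RSZ2020_7_3_exists_supercuspidal_testFunction : Prop :=
  ∀ v : D.Pl, D.IsSplit v → ¬ D.IsArch v → ∃ f : D.TestFnLoc v, D.HasSupercuspidalProperty v f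

/-- **Remark 7.3, display (7.6)** (p. 40): «for `f′` as in Proposition 7.2, we have an expansion for the first
derivative `d/ds|_{s=0} J(f′, s) = Σ_{ε(π)=−1} L(1,η)² L′(½, π₁ × π₂)/L(1,π,Ad) ∏_v J_{π_v}(f′_v, 0) +
Σ_{ε(π)=1} L(1,η)² L(½, π₁ × π₂)/L(1,π,Ad) · d/ds|_{s=0} ∏_v J_{π_v}(f′_v, s)`» (sums over base-change cuspidal `π`
with the given root number, as `HasSum`). [cite: RapoportSmithlingZhang2020Diagonal, Rem. 7.3 (7.6) (p. 40)] -/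
def RSZ2020_7_3_Eq76_derivative_expansion : Prop :=
  ∀ f : D.TestFn, D.HasSupercuspidalComponent f →
    ∃ A B : ℂ,
      HasSum (fun π : {π : D.CuspRep // D.IsBaseChange π ∧ D.rootNumber π = -1} =>
        D.Leta 1 ^ 2 * deriv (D.L π.1) (1 / 2) / D.Lad π.1 1 * D.prodJloc π.1 f 0) A ∧
      HasSum (fun π : {π : D.CuspRep // D.IsBaseChange π ∧ D.rootNumber π = 1} =>
        D.Leta 1 ^ 2 * D.L π.1 (1 / 2) / D.Lad π.1 1 * deriv (D.prodJloc π.1 f) 0) B ∧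
      deriv (D.J f) 0 = A + B

/-- **Definition 7.5** (p. 40): «A function `f′_ν ∈ C_c^∞(G′(F_{0,ν}))` has regular support if `supp(f′_ν) ⊂
G′(F_{0,ν})_rs`. A pure tensor `f′ = ⊗_v f′_v` has regular support at `ν` if `f′_ν` has regular support.»
[cite: RapoportSmithlingZhang2020Diagonal, Def. 7.5 (p. 40)] -/
def HasRegularSupportAt (f : D.TestFn) (v : D.Pl) : Prop := D.SuppRegular v (D.comp f v)

/-- (7.7)–(7.8) (p. 41): for `f′` with regular support at some place, «the integral (7.3) is absolutely convergent
for all `s`, and admits a decomposition into a finite sum `J(f′, s) = Σ_{γ ∈ G′(F₀)_rs/H′_{1,2}(F₀)} Orb(γ, f′,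
s)` (7.7), where each term is a product of local orbital integrals `Orb(γ, f′, s) = ∏_v Orb(γ, f′_v, s)`
(7.8)» (`Orb(γ, f′_v, s) = 1` for all but finitely many `v`, so the product is the `finprod`).
[cite: RapoportSmithlingZhang2020Diagonal, §7.2 (7.7)–(7.8) (p. 41)] -/
def RSZ2020_7_Eq77_Eq78_orbital_decomposition : Prop :=
  ∀ f : D.TestFn, (∃ v : D.Pl, D.HasRegularSupportAt f v) → ∀ s : ℂ,
    D.JConverges f s ∧ {γ : D.Orbit | D.orb γ f s ≠ 0}.Finite ∧
    D.J f s = ∑ᶠ γ : D.Orbit, D.orb γ f s ∧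
    ∀ γ : D.Orbit, {v : D.Pl | D.orbLoc γ v (D.comp f v) s ≠ 1}.Finite ∧
      D.orb γ f s = ∏ᶠ v : D.Pl, D.orbLoc γ v (D.comp f v) s

/-- (7.9) (p. 41): «`J(f′) := J(f′, 0)`». [cite: RapoportSmithlingZhang2020Diagonal, §7.2 (7.9) (p. 41)] -/
def J₀ (f : D.TestFn) : ℂ := D.J f 0

/-- (p. 41): «`J_v(f′, s) := Σ_γ Orb(γ, f′_v, s) · ∏_{u ≠ v} Orb(γ, f′_u)`» (`Orb(γ, f′_u) = Orb(γ, f′_u, 0)`;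
finite sum over the orbits as in (7.7)). [cite: RapoportSmithlingZhang2020Diagonal, §7.2 (p. 41)] -/
def Jv (f : D.TestFn) (v : D.Pl) (s : ℂ) : ℂ :=
  ∑ᶠ γ : D.Orbit, D.orbLoc γ v (D.comp f v) s * ∏ᶠ (u : D.Pl) (_ : u ≠ v), D.orbLoc γ u (D.comp f u) 0

/-- (7.10) (p. 41): «`∂J(f′) := d/ds|_{s=0} J(f′, s)`». [cite: RapoportSmithlingZhang2020Diagonal, §7.2 (7.10) (p. 41)] -/
def dJ (f : D.TestFn) : ℂ := deriv (D.J f) 0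

/-- (7.10) (p. 41): «`∂J_v(f′) := d/ds|_{s=0} J_v(f′, s)`». [cite: RapoportSmithlingZhang2020Diagonal, §7.2 (7.10) (p. 41)] -/
def dJv (f : D.TestFn) (v : D.Pl) : ℂ := deriv (D.Jv f v) 0

/-- (7.10) (p. 41): «`∂Orb(γ, f′_v) := d/ds|_{s=0} Orb(γ, f′_v, s)`». [cite: RapoportSmithlingZhang2020Diagonal, §7.2 (7.10) (p. 41)] -/
def dOrb (γ : D.Orbit) (f : D.TestFn) (v : D.Pl) : ℂ := deriv (D.orbLoc γ v (D.comp f v)) 0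

/-- (7.11)–(7.12) (p. 41), for `f′` with regular support at some place: «`∂J_v(f′) = Σ_γ ∂Orb(γ, f′_v) ∏_{u≠v}
Orb(γ, f′_u)` (7.11). Then we may decompose `∂J(f′) = Σ_v ∂J_v(f′)` (7.12)» (finite sums: `finsum`).
[cite: RapoportSmithlingZhang2020Diagonal, §7.2 (7.11)–(7.12) (p. 41)] -/
def RSZ2020_7_Eq711_Eq712 : Prop :=
  ∀ f : D.TestFn, (∃ v : D.Pl, D.HasRegularSupportAt f v) →
    (∀ v : D.Pl, D.dJv f v =
      ∑ᶠ γ : D.Orbit, D.dOrb γ f v * ∏ᶠ (u : D.Pl) (_ : u ≠ v), D.orbLoc γ u (D.comp f u) 0) ∧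
    D.dJ f = ∑ᶠ v : D.Pl, D.dJv f v

/-- §7.2 (p. 41), general `f′`: «the truncation process of Zydor [61] allows us to define a meromorphic
distribution `J(·, s)` which is holomorphic away from `s = −1`.» [cite: RapoportSmithlingZhang2020Diagonal, §7.2 (p. 41)] -/
def RSZ2020_7_J_holomorphic_away_from_neg_one : Prop :=
  ∀ f : D.TestFn, DifferentiableOn ℂ (D.J f) {s : ℂ | s ≠ -1}

/-! ## §7.3 Smooth transfer (pp. 41–43) -/

/-- (7.13) (p. 41): the adelic transfer factor «`ω(γ) = ∏_v ω_v(γ_v)`» (a finite product for `γ` adelic: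
`finprod`). [cite: RapoportSmithlingZhang2020Diagonal, §7.3 (7.13) (p. 41)] -/
def omega (γ : D.GadRs) : ℂ := ∏ᶠ v : D.Pl, D.omegaLoc v (D.locOf γ v)

/-- (7.14) (p. 42): «The transfer factor has the properties (1) (η-invariance) For `h₁ ∈ H′₁(𝔸_{F₀})` and `h₂ ∈
H′₂(𝔸_{F₀})`, we have `ω(h₁⁻¹ γ h₂) = η(h₂) ω(γ)`. (2) (product formula) For `γ ∈ G′(F₀)` we have `∏_v
ω_v(γ) = 1`.» [cite: RapoportSmithlingZhang2020Diagonal, §7.3 (7.14) (p. 42)] -/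
def RSZ2020_7_Eq714_transferFactor : Prop :=
  (∀ (h₁ : D.H1A) (γ : D.GadRs) (h₂ : D.H2A), D.omega (D.act h₁ γ h₂) = D.eta h₂ * D.omega γ) ∧
    (∀ γ : D.Grs, {v : D.Pl | D.omegaLoc v (D.locOf (D.diag γ) v) ≠ 1}.Finite ∧ D.omega (D.diag γ) = 1)

/-- The transfer factor of a tuple `γ = (γ_v)_{v ∣ p}`, `ω(γ) = ∏_{v∣p} ω_v(γ_v)` [Def. 7.6 p. 42].
[cite: RapoportSmithlingZhang2020Diagonal, Def. 7.6 (p. 42)] -/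
def omegaAt (p : Nat.Primes) (γ : (v : D.Pl) → D.Over v p → D.GlocRs v) : ℂ :=
  ∏ᶠ (v : D.Pl) (h : D.Over v p), D.omegaLoc v (γ v h)

/-- **Definition 7.6** (p. 42): «A function `f_p ∈ C_c^∞(H̃G(ℚ_p))` and a collection `(f′_v) ∈ ∏_{v∣p}
C_c^∞(G′(F_{0,v}))` of functions are transfers of each other if for any element `γ = (γ_v) ∈ ∏_{v∣p}
G′(F_{0,v})_rs`, the following identity holds: `ω(γ) ∏_{v∣p} Orb(γ_v, f′_v) = Orb(g, f_p)` whenever `g`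
matches `γ`; `= 0` if no `g ∈ H̃G(ℚ_p)` matches `γ`.» [cite: RapoportSmithlingZhang2020Diagonal, Def. 7.6 (p. 42)] -/
def AreTransfersAt (p : Nat.Primes) (fp : D.TestFnU p) (f' : (v : D.Pl) → D.Over v p → D.TestFnLoc v) : Prop :=
  ∀ γ : (v : D.Pl) → D.Over v p → D.GlocRs v,
    (∀ g : D.HGp p, D.IsRsU g → D.Matches g γ →
      D.omegaAt p γ * ∏ᶠ (v : D.Pl) (h : D.Over v p), D.orbLocElt (γ v h) (f' v h) = D.orbU g fp) ∧
    ((¬ ∃ g : D.HGp p, D.IsRsU g ∧ D.Matches g γ) →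
      D.omegaAt p γ * ∏ᶠ (v : D.Pl) (h : D.Over v p), D.orbLocElt (γ v h) (f' v h) = 0)

/-- **Definition 7.7** (p. 42): «A function `f_p ∈ C_c^∞(H̃G(ℚ_p))` is completely decomposed if it is of the
form `f_p = φ_p ⊗ ⊗_{v∣p} f_v` (7.16), where `φ_p ∈ C_c^∞(Z^ℚ(ℚ_p))` and `f_v ∈ C_c^∞(G_W(F_{0,v}))`.»
[cite: RapoportSmithlingZhang2020Diagonal, Def. 7.7 (7.16) (p. 42)] -/
def IsCompletelyDecomposed {p : Nat.Primes} (fp : D.TestFnU p) : Prop :=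
  ∃ (φ : D.TestFnZ p) (f : (v : D.Pl) → D.Over v p → D.TestFnGW v), fp = D.tensorAt p φ f

/-- A pure tensor `f = ⊗_p f_p` «is completely decomposed if `f_p` is completely decomposed for all `p`»
[Def. 7.7 p. 42]. [cite: RapoportSmithlingZhang2020Diagonal, Def. 7.7 (p. 42)] -/
def IsCompletelyDecomposedGlobal (f : D.TestFnUf) : Prop := ∀ p : Nat.Primes, D.IsCompletelyDecomposed (D.compU f p)

/-- **Remark 7.8** (p. 42): «Let `f_p = φ_p ⊗ ⊗_{v∣p} f_v` be completely decomposed. Set `c(φ_p) := ∫ φ_p(z)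
dz`. By Lemma 2.1, we have, for `g ∈ H̃G(ℚ_p)` corresponding to the collection `g_v ∈ (H × G)(F_{0,v})`,
`Orb(g, f_p) = c(φ_p) ∏_{v∣p} Orb(g_v, f_v)` … (for regular semisimple `g`, where (7.15) defines `Orb(g, f_p)`) If the orbital integrals of `f_p` do not vanish identically, then
`f_p` and `(f′_v)_{v∣p}` are transfers of each other in the sense of Definition 7.6 if and only if for some
non-zero constants `c_v` such that `c(φ_p) = ∏_{v∣p} c_v`, the functions `f_v` and `c_v f′_v` are transfers of
each other for each `v` in the sense of [43, §2].» [cite: RapoportSmithlingZhang2020Diagonal, Rem. 7.8 (p. 42)] -/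
def RSZ2020_7_8_completely_decomposed_transfer : Prop :=
  ∀ (p : Nat.Primes) (φ : D.TestFnZ p) (f : (v : D.Pl) → D.Over v p → D.TestFnGW v),
    (∀ g : D.HGp p, D.IsRsU g → D.orbU g (D.tensorAt p φ f) =
      D.cZ φ * ∏ᶠ (v : D.Pl) (h : D.Over v p), D.orbGW (D.glocOf g v h) (f v h)) ∧
    (D.OrbNonVanishing (D.tensorAt p φ f) → ∀ f' : (v : D.Pl) → D.Over v p → D.TestFnLoc v,
      (D.AreTransfersAt p (D.tensorAt p φ f) f' ↔
        ∃ c : (v : D.Pl) → D.Over v p → ℂ, (∀ v h, c v h ≠ 0) ∧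
          D.cZ φ = ∏ᶠ (v : D.Pl) (h : D.Over v p), c v h ∧
          ∀ (v : D.Pl) (h : D.Over v p), D.IsLocalTransfer (f v h) (D.smulLoc (c v h) (f' v h))))

/-- **Definition 7.9, local** (p. 43): for `v` archimedean, «`f′_v` is a Gaussian test function if it transfers to
the constant function `1` on `G_{W₀}(F_{0,v})`, where `W₀` denotes the negative-definite hermitian space, and
transfers to the zero function on `G_W(F_{0,v})` for any other hermitian space `W`.»
[cite: RapoportSmithlingZhang2020Diagonal, Def. 7.9 (p. 43)] -/
def IsGaussianLoc {v : D.Pl} (f : D.TestFnLoc v) : Prop :=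
  D.TransfersTo f (D.oneW0 v) ∧ ∀ W : D.Herm v, W ≠ D.W0 v → D.TransfersTo f (D.zeroW v W)

/-- **Definition 7.9, global** (p. 43): «A pure tensor `f′ = ⊗_v f′_v ∈ ℋ(G′(𝔸_{F₀}))` is a Gaussian test
function if the archimedean components `f′_v` for `v ∣ ∞` are all (up to scalar factor) Gaussian test
functions.» [cite: RapoportSmithlingZhang2020Diagonal, Def. 7.9 (p. 43)] -/
def IsGaussian (f : D.TestFn) : Prop :=
  ∀ v : D.Pl, D.IsArch v → ∃ (c : ℂ) (g : D.TestFnLoc v), c ≠ 0 ∧ D.IsGaussianLoc g ∧ D.comp f v = D.smulLoc c g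

/-- (7.17) (p. 43): with `vol(H_{W₀}(F_{0,v})) = 1`, «`f′_v` is a Gaussian test function if and only if for all
`γ ∈ G′(F_{0,v})_rs`, `ω_v(γ) Orb(γ, f′_v) = 1` if there exists `g ∈ G_{W₀}(F_{0,v})` matching `γ`; `0` if no
`g ∈ G_{W₀}(F_{0,v})` matches `γ`.» [cite: RapoportSmithlingZhang2020Diagonal, Def. 7.9 (7.17) (p. 43)] -/
def RSZ2020_7_Eq717_gaussian_criterion : Prop :=
  ∀ (v : D.Pl), D.IsArch v → ∀ f : D.TestFnLoc v,
    D.IsGaussianLoc f ↔ ∀ γ : D.GlocRs v,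
      ((∃ g : D.GW0pt v, D.MatchesW0 g γ) → D.omegaLoc v γ * D.orbLocElt γ f = 1) ∧
      ((¬ ∃ g : D.GW0pt v, D.MatchesW0 g γ) → D.omegaLoc v γ * D.orbLocElt γ f = 0)

/-- §7.3 (p. 43), the sentence after (7.17): «A Gaussian test function does not have regular support, in the
sense of Definition 7.5» — for local components.  (The sentence before it, on the EXISTENCE of Gaussian test
functions, is not a statement of the paper and is not typed.) [cite: RapoportSmithlingZhang2020Diagonal, §7.3 (p. 43)] -/
def RSZ2020_7_gaussian_not_regular_support : Prop :=
  ∀ (v : D.Pl), D.IsArch v → ∀ f : D.TestFnLoc v, D.IsGaussianLoc f → ¬ D.SuppRegular v f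

/-- **Definition 7.10** (p. 43): «A pure tensor `f = ⊗_p f_p ∈ ℋ(H̃G(𝔸_f))` and a pure tensor `f′ = ⊗_v f′_v ∈
ℋ(G′(𝔸_{F₀,f}))` are smooth transfers of each other if they are expressible in a way that `f_p` and
`(f′_v)_{v∣p}` are transfers of each other for each prime `p`» — «expressible in a way»: the components of a
pure tensor are determined only up to non-zero scalars `c_v`, almost all `1`, with `∏_v c_v = 1`; since Definition
7.6 is homogeneous in each `f′_v`, rescaling on the `f′` side suffices: an existential over such `c`.
[cite: RapoportSmithlingZhang2020Diagonal, Def. 7.10 (p. 43)] -/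
def AreSmoothTransfers (f : D.TestFnUf) (f' : D.TestFnf) : Prop :=
  ∃ c : D.Pl → ℂ, (∀ v : D.Pl, c v ≠ 0) ∧ {v : D.Pl | c v ≠ 1}.Finite ∧ ∏ᶠ v : D.Pl, c v = 1 ∧
    ∀ p : Nat.Primes, D.AreTransfersAt p (D.compU f p) (fun v _ => D.smulLoc (c v) (D.compf f' v))

/-- **Remark 7.11** (p. 43): «The existence of local smooth transfer is known for non-archimedean places [57];
hence for any `f ∈ ℋ(H̃G(𝔸_f))` as above, there exists a smooth transfer `f′ ∈ ℋ(G′(𝔸_{F₀,f}))` as above, and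
conversely.» [cite: RapoportSmithlingZhang2020Diagonal, Rem. 7.11 (p. 43)] -/
def RSZ2020_7_11_exists_smooth_transfer : Prop :=
  (∀ f : D.TestFnUf, ∃ f' : D.TestFnf, D.AreSmoothTransfers f f') ∧
    ∀ f' : D.TestFnf, ∃ f : D.TestFnUf, D.AreSmoothTransfers f f'

/-- **Lemma 7.12** (p. 43): «Let `f′ = ⊗_v f′_v ∈ ℋ(G′(𝔸_{F₀}))` be a Gaussian test function. Assume that `f′`
has regular support at some place `ν` of `F₀`. Then for any place `v₀` of `F₀` split in `F`, `∂J_{v₀}(f′) = 0`.»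
([55, Prop. 3.6 (ii)].) [cite: RapoportSmithlingZhang2020Diagonal, Lemma 7.12 (p. 43)] -/
def RSZ2020_7_12_dJv_vanishes_at_split : Prop :=
  ∀ f : D.TestFn, D.IsGaussian f → (∃ v : D.Pl, D.HasRegularSupportAt f v) →
    ∀ v₀ : D.Pl, D.IsSplit v₀ → D.dJv f v₀ = 0

/-- The printed laws of §7 together. [cite: RapoportSmithlingZhang2020Diagonal, §7 (pp. 38–43)] -/
def PrintedLaws7 : Prop :=
  D.RSZ2020_7_1_L_entire_functionalEquation ∧ D.RSZ2020_7_1_lambda_decomposition ∧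
    D.RSZ2020_7_1_lambda_derivative ∧ D.Eq74 ∧ D.RSZ2020_7_1_derivative_Jpi ∧
    D.RSZ2020_7_2_spectral_decomposition ∧ D.RSZ2020_7_3_exists_supercuspidal_testFunction ∧
    D.RSZ2020_7_3_Eq76_derivative_expansion ∧ D.RSZ2020_7_Eq77_Eq78_orbital_decomposition ∧
    D.RSZ2020_7_Eq711_Eq712 ∧ D.RSZ2020_7_J_holomorphic_away_from_neg_one ∧ D.RSZ2020_7_Eq714_transferFactor ∧
    D.RSZ2020_7_8_completely_decomposed_transfer ∧ D.RSZ2020_7_Eq717_gaussian_criterion ∧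
    D.RSZ2020_7_gaussian_not_regular_support ∧ D.RSZ2020_7_11_exists_smooth_transfer ∧
    D.RSZ2020_7_12_dJv_vanishes_at_split

end Sec7Data

end Literature.AlgebraicGeometry.ShimuraVarieties.RapoportSmithlingZhang2020.Sec7LFunctionsRTF
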